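import Summits.CriticalPhenomena.PercolationContinuityZ3.Theorems.Transplant.StaircaseWallCritical
import Summits.CriticalPhenomena.PercolationContinuityZ3.Theorems.Transplant.TiltedSectorCore
import HarnessLib

/-!
# The thick 3D horn `ℍ_f = {x₁ ≥ 0, 0 ≤ x₀ ≤ f(x₁), 0 ≤ x₂ ≤ f(x₁)}`: elementary geometry (membership of lattice points, connectivity)

builds on p205010 (kernel theorem, internal audit signed; external expert review pending) — NOT used in this file.
Lane `prim-bschramm`, seat `prim-bschramm-p2` (gen 25; class C1b; memo `HOME/bschramm/P2-LATTICES.md` §90, rows N5);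
helper file (`--supports stmt-CriticalPhenomena-4575 --as helper`).

Shared by the thick-horn row `f/log → ∞` (`HornCritical`) and the horn programme's assembly (`f²/log → ∞`): the horn
`ℍ_f = {x ∈ ℤ³ | x₁ ≥ 0, 0 ≤ x₂ ≤ f(x₁), 0 ≤ x₀ ≤ f(x₁)}` (the set of gen 24's `ColumnCut.horn_row`) contains the lattice points `(a, c, d)` with
`a, d ≤ f(c)` (**`natVec_mem_horn`**) and is connected: every vertex is joined inside `ℤ³[ℍ_f]` to the origin (**`reachable_zero`**).
[cite: GrimmettPercolation1999, §11.5 (11.50) (the planar analogue G(f)); §1.6 p. 16]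
-/

noncomputable section

namespace Summit.CriticalPhenomena.PercolationContinuityZ3.Theorems.Transplant

namespace Horn

open Literature.Probability.Percolation Literature.Probability.LatticeModels SimpleGraph

variable (f : ℕ → ℕ)

/-- Membership of an explicit lattice point `(a, c, d)` (natural coordinates) in the horn. [folklore] -/
theorem natVec_mem_horn {a c d : ℕ} (ha : a ≤ f c) (hd : d ≤ f c) :
    (![(a : ℤ), (c : ℤ), (d : ℤ)] : Site 3) ∈
      {x : Site 3 | 0 ≤ x 1 ∧ 0 ≤ x 2 ∧ x 2 ≤ (f (x 1).toNat : ℤ) ∧ 0 ≤ x 0 ∧ x 0 ≤ (f (x 1).toNat : ℤ)} := by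
  have ha' : ((a : ℕ) : ℤ) ≤ f c := by exact_mod_cast ha
  have hd' : ((d : ℕ) : ℤ) ≤ f c := by exact_mod_cast hd
  refine ⟨by simp, by simp, ?_, by simp, ?_⟩
  · simpa using hd'
  · simpa using ha'

/-- **The horn is connected**: every vertex `(a, c, d)` is joined inside `ℤ³[ℍ_f]` to the origin — along `(j, c, d)` down to `(0, c, d)`, then
`(0, c, j)` down to `(0, c, 0)`, then the axis `(0, j, 0)`. [folklore] -/
theorem reachable_zero (h0 : (0 : Site 3) ∈ {x : Site 3 | 0 ≤ x 1 ∧ 0 ≤ x 2 ∧ x 2 ≤ (f (x 1).toNat : ℤ) ∧ 0 ≤ x 0 ∧ x 0 ≤ (f (x 1).toNat : ℤ)})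
    (x : {x : Site 3 | 0 ≤ x 1 ∧ 0 ≤ x 2 ∧ x 2 ≤ (f (x 1).toNat : ℤ) ∧ 0 ≤ x 0 ∧ x 0 ≤ (f (x 1).toNat : ℤ)}) :
    ((zdGraph 3).induce {x : Site 3 | 0 ≤ x 1 ∧ 0 ≤ x 2 ∧ x 2 ≤ (f (x 1).toNat : ℤ) ∧ 0 ≤ x 0 ∧ x 0 ≤ (f (x 1).toNat : ℤ)}).Reachable
      ⟨0, h0⟩ x := by
  obtain ⟨y, hy1, hy2, hy2f, hy0, hy0f⟩ := x
  obtain ⟨c, hc⟩ := Int.eq_ofNat_of_zero_le hy1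
  obtain ⟨d, hd⟩ := Int.eq_ofNat_of_zero_le hy2
  obtain ⟨a, ha⟩ := Int.eq_ofNat_of_zero_le hy0
  have haf : a ≤ f c := by
    have : (a : ℤ) ≤ (f (y 1).toNat : ℤ) := ha ▸ hy0f
    rw [hc, Int.toNat_natCast] at this
    exact_mod_cast this
  have hdf : d ≤ f c := by
    have : (d : ℤ) ≤ (f (y 1).toNat : ℤ) := hd ▸ hy2f
    rw [hc, Int.toNat_natCast] at this
    exact_mod_cast this
  set D : Set (Site 3) := {x : Site 3 | 0 ≤ x 1 ∧ 0 ≤ x 2 ∧ x 2 ≤ (f (x 1).toNat : ℤ) ∧ 0 ≤ x 0 ∧ x 0 ≤ (f (x 1).toNat : ℤ)} with hD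
  have memD : ∀ a' c' d' : ℕ, a' ≤ f c' → d' ≤ f c' → (![(a' : ℤ), (c' : ℤ), (d' : ℤ)] : Site 3) ∈ D :=
    fun a' c' d' h1 h2 => natVec_mem_horn f h1 h2
  -- segment 1: the axis `(0, j, 0)`, `j ≤ c`
  have s1 : ∀ j : ℕ, j ≤ c → (0 : Site 3) + (j : ℤ) • (Pi.single 1 1 : Site 3) ∈ D := by
    intro j _
    have e : (0 : Site 3) + (j : ℤ) • (Pi.single 1 1 : Site 3) = ![((0 : ℕ) : ℤ), ((j : ℕ) : ℤ), ((0 : ℕ) : ℤ)] := by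
      ext l; rw [StairWall.add_smul_single_apply]; fin_cases l <;> simp
    rw [e]; exact memD 0 j 0 (Nat.zero_le _) (Nat.zero_le _)
  have e1 : (0 : Site 3) + (c : ℤ) • (Pi.single 1 1 : Site 3) = ![0, (c : ℤ), 0] := by
    ext l; rw [StairWall.add_smul_single_apply]; fin_cases l <;> simp
  -- segment 2: `(0, c, j)`, `j ≤ d`
  have s2 : ∀ j : ℕ, j ≤ d → (![0, (c : ℤ), 0] : Site 3) + (j : ℤ) • (Pi.single 2 1 : Site 3) ∈ D := by
    intro j hj
    have e : (![0, (c : ℤ), 0] : Site 3) + (j : ℤ) • (Pi.single 2 1 : Site 3) = ![((0 : ℕ) : ℤ), ((c : ℕ) : ℤ), ((j : ℕ) : ℤ)] := by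
      ext l; rw [StairWall.add_smul_single_apply]; fin_cases l <;> simp
    rw [e]; exact memD 0 c j (Nat.zero_le _) (hj.trans hdf)
  have e2 : (![0, (c : ℤ), 0] : Site 3) + (d : ℤ) • (Pi.single 2 1 : Site 3) = ![0, (c : ℤ), (d : ℤ)] := by
    ext l; rw [StairWall.add_smul_single_apply]; fin_cases l <;> simp
  -- segment 3: `(j, c, d)`, `j ≤ a`
  have s3 : ∀ j : ℕ, j ≤ a → (![0, (c : ℤ), (d : ℤ)] : Site 3) + (j : ℤ) • (Pi.single 0 1 : Site 3) ∈ D := by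
    intro j hj
    have e : (![0, (c : ℤ), (d : ℤ)] : Site 3) + (j : ℤ) • (Pi.single 0 1 : Site 3) = ![((j : ℕ) : ℤ), ((c : ℕ) : ℤ), ((d : ℕ) : ℤ)] := by
      ext l; rw [StairWall.add_smul_single_apply]; fin_cases l <;> simp
    rw [e]; exact memD j c d (hj.trans haf) hdf
  have e3 : (![0, (c : ℤ), (d : ℤ)] : Site 3) + (a : ℤ) • (Pi.single 0 1 : Site 3) = y := by
    ext l; rw [StairWall.add_smul_single_apply]; fin_cases l
    · simpa using ha.symm
    · simpa using hc.symm
    · simpa using hd.symm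
  have hz : (0 : Site 3) + ((0 : ℕ) : ℤ) • (Pi.single 1 1 : Site 3) = 0 := by simp
  have r1 := TiltSector.reachable_of_segment (D := D) 1 0 c s1 (hz.symm ▸ h0) (s1 c le_rfl)
  have r2 := TiltSector.reachable_of_segment (D := D) 2 ![0, (c : ℤ), 0] d s2 (e1 ▸ s1 c le_rfl) (s2 d le_rfl)
  have r3 := TiltSector.reachable_of_segment (D := D) 0 ![0, (c : ℤ), (d : ℤ)] a s3 (e2 ▸ s2 d le_rfl) (s3 a le_rfl)
  have j1 : (⟨(0 : Site 3) + (c : ℤ) • (Pi.single 1 1 : Site 3), s1 c le_rfl⟩ : D) = ⟨![0, (c : ℤ), 0], e1 ▸ s1 c le_rfl⟩ :=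
    Subtype.ext e1
  have j2 : (⟨(![0, (c : ℤ), 0] : Site 3) + (d : ℤ) • (Pi.single 2 1 : Site 3), s2 d le_rfl⟩ : D) =
      ⟨![0, (c : ℤ), (d : ℤ)], e2 ▸ s2 d le_rfl⟩ := Subtype.ext e2
  have j3 : (⟨(![0, (c : ℤ), (d : ℤ)] : Site 3) + (a : ℤ) • (Pi.single 0 1 : Site 3), s3 a le_rfl⟩ : D) =
      ⟨y, ⟨hy1, hy2, hy2f, hy0, hy0f⟩⟩ := Subtype.ext e3
  rw [j1] at r1
  rw [j2] at r2
  rw [j3] at r3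
  exact r1.trans (r2.trans r3)

/-- The origin lies in the horn. [folklore] -/
theorem zero_mem_horn : (0 : Site 3) ∈ {x : Site 3 | 0 ≤ x 1 ∧ 0 ≤ x 2 ∧ x 2 ≤ (f (x 1).toNat : ℤ) ∧ 0 ≤ x 0 ∧ x 0 ≤ (f (x 1).toNat : ℤ)} :=
  ⟨le_rfl, le_rfl, by simp, le_rfl, by simp⟩

/-- **Any two vertices of the horn are joined inside `ℤ³[ℍ_f]`.** [folklore] -/
theorem reachable (x y : {x : Site 3 | 0 ≤ x 1 ∧ 0 ≤ x 2 ∧ x 2 ≤ (f (x 1).toNat : ℤ) ∧ 0 ≤ x 0 ∧ x 0 ≤ (f (x 1).toNat : ℤ)}) :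
    ((zdGraph 3).induce {x : Site 3 | 0 ≤ x 1 ∧ 0 ≤ x 2 ∧ x 2 ≤ (f (x 1).toNat : ℤ) ∧ 0 ≤ x 0 ∧ x 0 ≤ (f (x 1).toNat : ℤ)}).Reachable x y :=
  (reachable_zero f (zero_mem_horn f) x).symm.trans (reachable_zero f (zero_mem_horn f) y)

end Horn

end Summit.CriticalPhenomena.PercolationContinuityZ3.Theorems.Transplant

end
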